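import Summits.CriticalPhenomena.SAWScalingLimit.Theorems.SAWDefectDecoherenceObservableToSLERTwoPieceAdmIdentificationWalks
import HarnessLib

/-!
# Rows, row walks and the SHIFTED SHADOW of an exterior path (piece (G2-fam-a) of stub T2b″)

Crux `SAWDevelopingMap.ObservableToSLE` (stmt-CriticalPhenomena-10472), line `six-class-type-ladder`,
stub T2b″.  Landing target:
`Summits/CriticalPhenomena/SAWScalingLimit/Theorems/SAWDevelopingMapObservableToSLETypeLadderCarvedReductionSqueezeShadow.lean`
(`--supports stmt-CriticalPhenomena-10472`).

The repaired squeeze applies ARL″ in a TWO-PIECE flat Jordan domain `E` (flat at its two marked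
points at DIFFERENT heights), so it needs an admissible lattice family of `E` — the two-piece port of
the inner admissible discretisation (M1) of the floor line (`FloorRatio.exists_innerFamily`, which
assumes a GLOBAL floor `Ω ⊆ {Im > h}`).  As there, the family is the main component of a set `S` of
DEEP vertices; here "deep" means: `δ c_u ∈ Ω`; in the square box of half-width `ρₓ` about the flat
point `p i` the row of `u` is at least the threshold row `μ i` (the thresholds are FREE, possibly
many rows above the floor row — the far gate of the carved domains approaches its limit height only
at speed `o(1)`); and the closed `r`-disc about `δ c_u` lies in `U = Ω ∪ B(p 0, ϱ) ∪ B(p 1, ϱ)`.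
The escape lemma of that set (sequel file `…SqueezeEscape`) ends every escape by shadowing an EXTERIOR
path to a far exterior point.  This file provides its lattice inputs: row/height bookkeeping
(`row_le_of_im_le`, `im_lt_of_row_lt`, `abs_im_sub_im_le_of_row_eq`), walks ALONG a zigzag row
(`exists_walk_rowLeft`, `exists_walk_rowRight`: abscissa moves by exactly `δ/2` per step, row fixed),
and THE SHIFTED SHADOW (`twoPiece_exists_pathIn_shadow`, registered as
`stub_carvedReduction_twoPieceShadow`): the lattice shadow is taken along the exterior path SHIFTED
DOWN by `5δ`, which makes every exterior path safe at once — near exterior points outside the exempt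
discs the shadow sees a witness outside `U`, and inside an exempt disc (where exterior points lie on
or below the flat floor) it runs strictly below the floor, hence outside `Ω ⊇ S`.  No stopping sets,
no first-entry decompositions (contrast `FloorRatio.exists_pathIn_escape`).

Sources: H. Duminil-Copin, S. Smirnov, Ann. of Math. 175 (2012) §3 (domains of the hexagonal
lattice); G. Grimmett, Percolation (1999) §1.6 (lattice paths).
-/

noncomputable section

open scoped Topology
open Filter Set Metric
open Literature.Probability.LatticeModels (HexVertex hexGraph hexCenter Site)
open Literature.Probability.RandomPlanarGeometry
open Literature.Probability.RandomPlanarGeometry.SAW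
open Literature.Probability.Percolation (PathIn hexCenter_im hexCenter_re)

namespace Summit.CriticalPhenomena.SAWScalingLimit.Theorems.ObservableToSLE.TypeLadder

open Summit.CriticalPhenomena.SAWScalingLimit.Theorems.ObservableToSLE.FloorRatio
open Summit.CriticalPhenomena.SAWScalingLimit.Theorems.ObservableToSLER.TwoPiece
  (exists_walk_column re_smul_hexCenter exists_walk_within_of_isPreconnected)

/-! ### Rows and heights -/

/-- A vertex which is not higher than `v` (at a positive mesh) lies in a row not above that of `v`
(the two heights of a zigzag row are below both heights of the next row). -/
theorem row_le_of_im_le {δ : ℝ} (hδ : 0 < δ) {u v : HexVertex}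
    (h : ((δ : ℂ) * hexCenter u).im ≤ ((δ : ℂ) * hexCenter v).im) : u.1 1 ≤ v.1 1 := by
  by_contra hlt
  push Not at hlt
  have h1 : (v.1 1 : ℝ) + 1 ≤ (u.1 1 : ℝ) := by exact_mod_cast hlt
  rw [im_smul_hexCenter, im_smul_hexCenter] at h
  have hk : 0 < δ * (Real.sqrt 3 / 2) := by positivity
  have hu2 : (0 : ℝ) ≤ ((u.2 : ℕ) : ℝ) := by positivity
  have hv2 : (((v.2 : ℕ) : ℝ)) ≤ 1 := by
    have := v.2.isLt
    exact_mod_cast Nat.lt_succ_iff.1 this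
  have : δ * (((v.1 1 : ℝ) + ((v.2 : ℕ) + 1) / 3) * (Real.sqrt 3 / 2)) <
      δ * (((u.1 1 : ℝ) + ((u.2 : ℕ) + 1) / 3) * (Real.sqrt 3 / 2)) := by
    rw [show ∀ t : ℝ, δ * (t * (Real.sqrt 3 / 2)) = t * (δ * (Real.sqrt 3 / 2)) from fun t => by ring,
      show ∀ t : ℝ, δ * (t * (Real.sqrt 3 / 2)) = t * (δ * (Real.sqrt 3 / 2)) from fun t => by ring]
    exact mul_lt_mul_of_pos_right (by linarith) hk
  linarith

/-- Heights of the vertices of row `< μ`: below the lowest height `(μ + 1/3) δ√3/2` of row `μ`. -/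
theorem im_lt_of_row_lt {δ : ℝ} (hδ : 0 < δ) {u : HexVertex} {μ : ℤ} (h : u.1 1 < μ) :
    ((δ : ℂ) * hexCenter u).im < ((μ : ℝ) + 1 / 3) * (δ * (Real.sqrt 3 / 2)) := by
  have h1 : (u.1 1 : ℝ) + 1 ≤ (μ : ℝ) := by exact_mod_cast h
  rw [im_smul_hexCenter]
  have hk : 0 < δ * (Real.sqrt 3 / 2) := by positivity
  have hu2 : (((u.2 : ℕ) : ℝ)) ≤ 1 := by
    have := u.2.isLt
    exact_mod_cast Nat.lt_succ_iff.1 this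
  rw [show δ * (((u.1 1 : ℝ) + ((u.2 : ℕ) + 1) / 3) * (Real.sqrt 3 / 2)) =
    ((u.1 1 : ℝ) + ((u.2 : ℕ) + 1) / 3) * (δ * (Real.sqrt 3 / 2)) by ring]
  exact mul_lt_mul_of_pos_right (by linarith) hk

/-- Two vertices of the same row have heights within `δ` of each other (in fact `δ√3/6`). -/
theorem abs_im_sub_im_le_of_row_eq {δ : ℝ} (hδ : 0 ≤ δ) {u v : HexVertex} (h : u.1 1 = v.1 1) :
    |((δ : ℂ) * hexCenter u).im - ((δ : ℂ) * hexCenter v).im| ≤ δ := by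
  rw [im_smul_hexCenter, im_smul_hexCenter, h]
  have hs : Real.sqrt 3 / 2 ≤ 1 := by
    rw [div_le_one (by norm_num : (0:ℝ) < 2)]
    have := Real.sqrt_le_sqrt (show (3:ℝ) ≤ 4 by norm_num)
    rwa [show (4:ℝ) = 2 ^ 2 by norm_num, Real.sqrt_sq (by norm_num : (0:ℝ) ≤ 2)] at this
  have hs0 : 0 ≤ Real.sqrt 3 / 2 := by positivity
  have hu2 : (((u.2 : ℕ) : ℝ)) ≤ 1 := by
    have := u.2.isLt
    exact_mod_cast Nat.lt_succ_iff.1 this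
  have hv2 : (((v.2 : ℕ) : ℝ)) ≤ 1 := by
    have := v.2.isLt
    exact_mod_cast Nat.lt_succ_iff.1 this
  have hu0 : (0 : ℝ) ≤ ((u.2 : ℕ) : ℝ) := by positivity
  have hv0 : (0 : ℝ) ≤ ((v.2 : ℕ) : ℝ) := by positivity
  rw [show δ * (((v.1 1 : ℝ) + ((u.2 : ℕ) + 1) / 3) * (Real.sqrt 3 / 2)) -
      δ * (((v.1 1 : ℝ) + ((v.2 : ℕ) + 1) / 3) * (Real.sqrt 3 / 2)) =
      δ * (Real.sqrt 3 / 2) * ((((u.2 : ℕ) : ℝ) - ((v.2 : ℕ) : ℝ)) / 3) by ring]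
  rw [abs_le]
  have hk : |(((u.2 : ℕ) : ℝ) - ((v.2 : ℕ) : ℝ)) / 3| ≤ 1 / 3 := by
    rw [abs_le]; constructor <;> linarith
  have hprod : 0 ≤ δ * (Real.sqrt 3 / 2) := by positivity
  have hprod1 : δ * (Real.sqrt 3 / 2) ≤ δ := by nlinarith
  obtain ⟨hk1, hk2⟩ := abs_le.1 hk
  constructor <;> nlinarith

/-! ### Walks along a row -/

/-- One step to the LEFT inside a zigzag row: from the down-face `(x, 1)` to the up-face `(x, 0)`,
from the up-face `(x, 0)` to the down-face `(x - e₀, 1)`; the row is unchanged and the abscissa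
decreases by exactly `δ/2`. -/
theorem exists_adj_rowLeft (δ : ℝ) (v : HexVertex) :
    ∃ w : HexVertex, hexGraph.Adj v w ∧ w.1 1 = v.1 1 ∧
      ((δ : ℂ) * hexCenter w).re = ((δ : ℂ) * hexCenter v).re - δ / 2 := by
  obtain ⟨x, k⟩ := v
  fin_cases k
  · refine ⟨(x - Pi.single 0 1, 1), ?_, by simp, ?_⟩
    · exact (hexGraph_adj_iff_coord x (x - Pi.single 0 1) 0 1).2
        (Or.inl ⟨rfl, rfl, Or.inr (Or.inl ⟨by simp, by simp⟩)⟩)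
    · rw [re_smul_hexCenter, re_smul_hexCenter]
      simp only [Pi.sub_apply, Pi.single_eq_same, Int.cast_sub, Int.cast_one, Fin.val_one,
        Nat.cast_one, Nat.cast_zero,
        Pi.single_eq_of_ne (show (1 : Fin 2) ≠ 0 by decide), sub_zero]
      ring
  · refine ⟨(x, 0), ?_, rfl, ?_⟩
    · exact (hexGraph_adj_iff_coord x x 1 0).2 (Or.inr ⟨rfl, rfl, Or.inl ⟨rfl, rfl⟩⟩)
    · rw [re_smul_hexCenter, re_smul_hexCenter]
      simp only [Nat.cast_one, Fin.val_zero, Nat.cast_zero]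
      ring

/-- One step to the RIGHT inside a zigzag row: from `(x, 0)` to `(x, 1)`, from `(x, 1)` to
`(x + e₀, 0)`; the row is unchanged and the abscissa increases by exactly `δ/2`. -/
theorem exists_adj_rowRight (δ : ℝ) (v : HexVertex) :
    ∃ w : HexVertex, hexGraph.Adj v w ∧ w.1 1 = v.1 1 ∧
      ((δ : ℂ) * hexCenter w).re = ((δ : ℂ) * hexCenter v).re + δ / 2 := by
  obtain ⟨x, k⟩ := v
  fin_cases k
  · refine ⟨(x, 1), ?_, rfl, ?_⟩
    · exact (hexGraph_adj_iff_coord x x 0 1).2 (Or.inl ⟨rfl, rfl, Or.inl ⟨rfl, rfl⟩⟩)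
    · rw [re_smul_hexCenter, re_smul_hexCenter]
      simp only [Fin.val_one, Nat.cast_one, Nat.cast_zero]
      ring
  · refine ⟨(x + Pi.single 0 1, 0), ?_, by simp, ?_⟩
    · exact (hexGraph_adj_iff_coord x (x + Pi.single 0 1) 1 0).2
        (Or.inr ⟨rfl, rfl, Or.inr (Or.inl ⟨by simp, by simp⟩)⟩)
    · rw [re_smul_hexCenter, re_smul_hexCenter]
      simp only [Pi.add_apply, Pi.single_eq_same, Int.cast_add, Int.cast_one,
        Nat.cast_one, Fin.val_zero, Nat.cast_zero,
        Pi.single_eq_of_ne (show (1 : Fin 2) ≠ 0 by decide), add_zero]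
      ring

/-- **Walk of `n` steps to the left along a row**: it ends at abscissa `Re(δ c_v) - n δ/2`, and
all its vertices lie in the row of `v` with abscissa between the two ends. -/
theorem exists_walk_rowLeft (δ : ℝ) (hδ : 0 ≤ δ) (v : HexVertex) (n : ℕ) :
    ∃ (w : HexVertex) (p : hexGraph.Walk v w), w.1 1 = v.1 1 ∧
      ((δ : ℂ) * hexCenter w).re = ((δ : ℂ) * hexCenter v).re - n * (δ / 2) ∧
      ∀ u ∈ p.support, u.1 1 = v.1 1 ∧
        ((δ : ℂ) * hexCenter v).re - n * (δ / 2) ≤ ((δ : ℂ) * hexCenter u).re ∧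
        ((δ : ℂ) * hexCenter u).re ≤ ((δ : ℂ) * hexCenter v).re := by
  induction n generalizing v with
  | zero =>
    refine ⟨v, SimpleGraph.Walk.nil, rfl, by simp, fun u hu => ?_⟩
    rw [SimpleGraph.Walk.support_nil, List.mem_singleton] at hu
    subst hu
    simp
  | succ n ih =>
    obtain ⟨v', hadj, hrow, hre⟩ := exists_adj_rowLeft δ v
    obtain ⟨w, p, hw, hwre, hp⟩ := ih v'
    refine ⟨w, SimpleGraph.Walk.cons hadj p, hw.trans hrow, ?_, fun u hu => ?_⟩
    · rw [hwre, hre]; push_cast; ring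
    · rw [SimpleGraph.Walk.support_cons, List.mem_cons] at hu
      rcases hu with rfl | hu
      · refine ⟨rfl, ?_, le_rfl⟩
        have : (0 : ℝ) ≤ (n + 1 : ℕ) * (δ / 2) := by positivity
        linarith
      · obtain ⟨h1, h2, h3⟩ := hp u hu
        refine ⟨h1.trans hrow, ?_, ?_⟩
        · rw [hre] at h2; push_cast at h2 ⊢; linarith
        · rw [hre] at h3; linarith

/-- **Walk of `n` steps to the right along a row**: it ends at abscissa `Re(δ c_v) + n δ/2`, and
all its vertices lie in the row of `v` with abscissa between the two ends. -/
theorem exists_walk_rowRight (δ : ℝ) (hδ : 0 ≤ δ) (v : HexVertex) (n : ℕ) :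
    ∃ (w : HexVertex) (p : hexGraph.Walk v w), w.1 1 = v.1 1 ∧
      ((δ : ℂ) * hexCenter w).re = ((δ : ℂ) * hexCenter v).re + n * (δ / 2) ∧
      ∀ u ∈ p.support, u.1 1 = v.1 1 ∧
        ((δ : ℂ) * hexCenter v).re ≤ ((δ : ℂ) * hexCenter u).re ∧
        ((δ : ℂ) * hexCenter u).re ≤ ((δ : ℂ) * hexCenter v).re + n * (δ / 2) := by
  induction n generalizing v with
  | zero =>
    refine ⟨v, SimpleGraph.Walk.nil, rfl, by simp, fun u hu => ?_⟩
    rw [SimpleGraph.Walk.support_nil, List.mem_singleton] at hu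
    subst hu
    simp
  | succ n ih =>
    obtain ⟨v', hadj, hrow, hre⟩ := exists_adj_rowRight δ v
    obtain ⟨w, p, hw, hwre, hp⟩ := ih v'
    refine ⟨w, SimpleGraph.Walk.cons hadj p, hw.trans hrow, ?_, fun u hu => ?_⟩
    · rw [hwre, hre]; push_cast; ring
    · rw [SimpleGraph.Walk.support_cons, List.mem_cons] at hu
      rcases hu with rfl | hu
      · refine ⟨rfl, le_rfl, ?_⟩
        have : (0 : ℝ) ≤ (n + 1 : ℕ) * (δ / 2) := by positivity
        linarith
      · obtain ⟨h1, h2, h3⟩ := hp u hu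
        refine ⟨h1.trans hrow, ?_, ?_⟩
        · rw [hre] at h2; linarith
        · rw [hre] at h3; push_cast at h3 ⊢; linarith

/-! ### Elementary metric facts -/

/-- `dist z w ≤ |Re (z - w)| + |Im (z - w)|`. -/
theorem dist_le_abs_re_add_abs_im (z w : ℂ) : dist z w ≤ |(z - w).re| + |(z - w).im| := by
  rw [dist_eq_norm]
  exact Complex.norm_le_abs_re_add_abs_im _

/-- The imaginary parts of two points differ by at most their distance. -/
theorem im_sub_im_le_dist (z w : ℂ) : z.im - w.im ≤ dist z w := by
  rw [dist_eq_norm, ← Complex.sub_im]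
  exact (le_abs_self _).trans (Complex.abs_im_le_norm _)

/-! ### The two-piece deep set: the escape lemma -/

section TwoPieceEscape

variable {Ω : Set ℂ} {p : Fin 2 → ℂ} {ρ ρₓ ϱ δ r R : ℝ} {μ : Fin 2 → ℤ} {S : Set HexVertex}

/-- In a flat disc, points on or below the floor are not in the domain. -/
theorem twoPiece_notMem_of_le_im (hflΩ : ∀ i, Ω ∩ ball (p i) ρ ⊆ {z : ℂ | (p i).im < z.im})
    {i : Fin 2} {z : ℂ} (hz : z ∈ ball (p i) ρ) (him : z.im ≤ (p i).im) : z ∉ Ω :=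
  fun hzΩ => (hflΩ i ⟨hzΩ, hz⟩).not_ge him

/-- In a flat disc, points outside the domain are on or below the floor. -/
theorem twoPiece_im_le_of_notMem (hflH : ∀ i, {z : ℂ | (p i).im < z.im} ∩ ball (p i) ρ ⊆ Ω)
    {i : Fin 2} {z : ℂ} (hz : z ∈ ball (p i) ρ) (hzΩ : z ∉ Ω) : z.im ≤ (p i).im := by
  by_contra h
  push Not at h
  exact hzΩ (hflH i ⟨h, hz⟩)

/-- **The shifted shadow of an exterior path.**  Let `S` be a set of vertices `u` with
`δ c_u ∈ Ω` whose closed `r`-discs lie in `U = Ω ∪ ⋃ B(p i, ϱ)` (`9δ ≤ r`, `ϱ + 9δ ≤ ρ`, `Ω`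
flat in `B(p i, ρ)` and bounded by `R`).  From every vertex within `4δ` of the point `5δ` BELOW an
exterior point `e ∉ cl Ω` there is a lattice path OUTSIDE `S` to a vertex of norm `≥ R + 5δ`: it
shadows, within `4δ`, an exterior path from `e` to the far point `R + 12δ` shifted down by `5δ`;
a vertex of `S` on it would see the corresponding exterior point in its disc, hence in an exempt
disc, hence on or below that floor — and then the vertex itself is below the floor, outside `Ω`. -/
theorem twoPiece_exists_pathIn_shadow (hδ : 0 < δ) (hr : 9 * δ ≤ r) (hϱ : ϱ + 9 * δ ≤ ρ)
    (hR0 : 0 ≤ R) (hR : ∀ z ∈ Ω, ‖z‖ < R) (hE : IsConnected (closure Ω)ᶜ)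
    (hflΩ : ∀ i, Ω ∩ ball (p i) ρ ⊆ {z : ℂ | (p i).im < z.im})
    (hflH : ∀ i, {z : ℂ | (p i).im < z.im} ∩ ball (p i) ρ ⊆ Ω)
    (hS : ∀ u ∈ S, (δ : ℂ) * hexCenter u ∈ Ω ∧
      closedBall ((δ : ℂ) * hexCenter u) r ⊆ Ω ∪ ⋃ i, ball (p i) ϱ)
    {e : ℂ} (he : e ∈ (closure Ω)ᶜ) {s₀ : HexVertex}
    (hs₀ : dist ((δ : ℂ) * hexCenter s₀) (e - ((5 * δ : ℝ) : ℂ) * Complex.I) ≤ 4 * δ) :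
    ∃ w : HexVertex, R + 5 * δ ≤ ‖(δ : ℂ) * hexCenter w‖ ∧ PathIn hexGraph Sᶜ s₀ w := by
  -- the shift and the far exterior point
  set sh : ℂ → ℂ := fun z => z - ((5 * δ : ℝ) : ℂ) * Complex.I with hsh
  have hsh_dist : ∀ z : ℂ, dist (sh z) z = 5 * δ := by
    intro z
    rw [hsh, dist_eq_norm, sub_sub_cancel_left, norm_neg, norm_mul, Complex.norm_real,
      Complex.norm_I, mul_one, Real.norm_of_nonneg (by positivity)]
  have hsh_im : ∀ z : ℂ, (sh z).im = z.im - 5 * δ := fun z => by simp [hsh]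
  set qf : ℂ := ((R + 12 * δ : ℝ) : ℂ) with hqf
  have hclΩ : closure Ω ⊆ closedBall (0 : ℂ) R :=
    (closure_mono fun z hz => mem_ball_zero_iff.2 (hR z hz)).trans closure_ball_subset_closedBall
  have hqfE : qf ∈ (closure Ω)ᶜ := by
    intro h
    have h1 := mem_closedBall_zero_iff.1 (hclΩ h)
    rw [hqf, Complex.norm_real, Real.norm_of_nonneg (by positivity)] at h1
    linarith
  -- an exterior path from `e` to `qf`, shifted down
  have hEo : IsOpen (closure Ω)ᶜ := isClosed_closure.isOpen_compl
  have hpc : IsPathConnected (closure Ω)ᶜ := hEo.isConnected_iff_isPathConnected.1 hE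
  have hJ : JoinedIn (closure Ω)ᶜ e qf := hpc.joinedIn e he qf hqfE
  set γ : Path e qf := hJ.somePath with hγ
  set P : Set ℂ := sh '' range γ with hP
  have hPc : IsPreconnected P :=
    (isConnected_range γ.continuous).isPreconnected.image _ (by fun_prop : Continuous sh).continuousOn
  have hx : sh e ∈ P := ⟨e, ⟨0, γ.source⟩, rfl⟩
  have hy : sh qf ∈ P := ⟨qf, ⟨1, γ.target⟩, rfl⟩
  obtain ⟨w, pw, hwy, hsupp⟩ :=
    exists_walk_within_of_isPreconnected hPc hδ (r := 4 * δ) (by linarith) hx hy hs₀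
  refine ⟨w, ?_, pathIn_of_walk pw fun u hu huS => ?_⟩
  · -- the end is far
    have h1 : ‖sh qf‖ ≤ ‖(δ : ℂ) * hexCenter w‖ + dist ((δ : ℂ) * hexCenter w) (sh qf) := by
      rw [dist_comm, dist_eq_norm]; exact norm_le_norm_add_norm_sub' (sh qf) ((δ : ℂ) * hexCenter w)
    have h2 : R + 12 * δ ≤ ‖sh qf‖ := by
      have h3 : (sh qf).re = R + 12 * δ := by simp [hsh, hqf]
      rw [← h3]
      exact (le_abs_self _).trans (Complex.abs_re_le_norm _)
    linarith
  · -- no vertex of `S` on the shadow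
    obtain ⟨z', ⟨z, ⟨t, rfl⟩, rfl⟩, hd⟩ := hsupp u hu
    have hzE : γ t ∈ (closure Ω)ᶜ := hJ.somePath_mem t
    have hzΩ : γ t ∉ Ω := fun h => hzE (subset_closure h)
    obtain ⟨huΩ, hdisc⟩ := hS u huS
    have hduz : dist ((δ : ℂ) * hexCenter u) (γ t) ≤ 9 * δ := by
      calc dist ((δ : ℂ) * hexCenter u) (γ t)
          ≤ dist ((δ : ℂ) * hexCenter u) (sh (γ t)) + dist (sh (γ t)) (γ t) := dist_triangle _ _ _
        _ ≤ 4 * δ + 5 * δ := add_le_add hd (hsh_dist _).le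
        _ = 9 * δ := by ring
    have hzU : γ t ∈ Ω ∪ ⋃ i, ball (p i) ϱ :=
      hdisc (mem_closedBall.2 (by rw [dist_comm]; exact hduz.trans hr))
    rcases hzU with hzΩ' | hzb
    · exact hzΩ hzΩ'
    · obtain ⟨i, hzi⟩ := mem_iUnion.1 hzb
      have hziρ : γ t ∈ ball (p i) ρ := ball_subset_ball (by linarith) hzi
      have hzim : (γ t).im ≤ (p i).im := twoPiece_im_le_of_notMem hflH hziρ hzΩ
      have huim : ((δ : ℂ) * hexCenter u).im ≤ (p i).im := by
        have h1 := im_sub_im_le_dist ((δ : ℂ) * hexCenter u) (sh (γ t))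
        rw [hsh_im] at h1
        linarith
      have huball : (δ : ℂ) * hexCenter u ∈ ball (p i) ρ := by
        rw [mem_ball]
        calc dist ((δ : ℂ) * hexCenter u) (p i)
            ≤ dist ((δ : ℂ) * hexCenter u) (γ t) + dist (γ t) (p i) := dist_triangle _ _ _
          _ < 9 * δ + ϱ := add_lt_add_of_le_of_lt hduz (mem_ball.1 hzi)
          _ ≤ ρ := by linarith
      exact twoPiece_notMem_of_le_im hflΩ huball huim huΩ

/-- **Registered sub-goal `stub_carvedReduction_twoPieceShadow`** (crux item
stmt-CriticalPhenomena-10472, stub T2b″ `stub_carvedReduction_squeezeSolid`, piece (G2-fam-a) THE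
SHIFTED SHADOW OF AN EXTERIOR PATH): registry form of `twoPiece_exists_pathIn_shadow`. -/
theorem stub_carvedReduction_twoPieceShadow :
    ∀ (Ω : Set ℂ) (p : Fin 2 → ℂ) (ρ ϱ δ r R : ℝ) (S : Set HexVertex) (e : ℂ) (s₀ : HexVertex),
      0 < δ → 9 * δ ≤ r → ϱ + 9 * δ ≤ ρ → 0 ≤ R → (∀ z ∈ Ω, ‖z‖ < R) → IsConnected (closure Ω)ᶜ →
      (∀ i, Ω ∩ ball (p i) ρ ⊆ {z : ℂ | (p i).im < z.im}) →
      (∀ i, {z : ℂ | (p i).im < z.im} ∩ ball (p i) ρ ⊆ Ω) →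
      (∀ u ∈ S, (δ : ℂ) * hexCenter u ∈ Ω ∧
        closedBall ((δ : ℂ) * hexCenter u) r ⊆ Ω ∪ ⋃ i, ball (p i) ϱ) →
      e ∈ (closure Ω)ᶜ → dist ((δ : ℂ) * hexCenter s₀) (e - ((5 * δ : ℝ) : ℂ) * Complex.I) ≤ 4 * δ →
      ∃ w : HexVertex, R + 5 * δ ≤ ‖(δ : ℂ) * hexCenter w‖ ∧ PathIn hexGraph Sᶜ s₀ w :=
  fun _ _ _ _ _ _ _ _ _ _ hδ hr hϱ hR0 hR hE hflΩ hflH hS he hs₀ =>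
    twoPiece_exists_pathIn_shadow hδ hr hϱ hR0 hR hE hflΩ hflH hS he hs₀

end TwoPieceEscape

end Summit.CriticalPhenomena.SAWScalingLimit.Theorems.ObservableToSLE.TypeLadder

end
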